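import Summits.BirchSwinnertonDyer.BirchSwinnertonDyer.Theorems.ByReductionTypeAtTwoAdditiveKatoFineDivisionFieldFourI
import Literature.NumberTheory.QuadraticForms.QuadraticNormLocalCFT
import Literature.NumberTheory.GaloisRepresentations.LocalExistenceReciprocity
import HarnessLib

/-!
# Route `ByReductionTypeAtTwo` (rung K4), crux `AdditiveRankZeroAtTwo` (item stmt-BirchSwinnertonDyer-19098),
# line add_twist_overK v2, stub `stub_addDefectUpper` (hU3): Coates–Sujatha's statement (A) at `(E, 2)` is a
# THEOREM FROM PRINT whenever `ℚ(E[2])/ℚ` is ABELIAN — i.e. UNLESS `Gal(ℚ(E[2])/ℚ) ≅ S₃` — through the honest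
# totally imaginary carrier `ℚ(E[2], √−1)` (a `--supports` file; seat `bsd-2adic-addL2x` GEN 9; sequel of
# `…KatoFineDivisionFieldFourI.lean`; outside the route file's import cone)

HONEST FRAMING (cell `bsd-2adic`, HUMAN RULING D-0036/D-0054): types-the-object-of; closes none at the ∀-level;
nothing booked; BSD is not proved by any of this. CONDITIONAL ONLY on the two PRINT facts named (`hLim2`, `hFW`).

WHAT THIS FILE DOES. `…KatoFineConjAReducible.lean` (GEN 9) made (A)`(W,2)` a theorem for REDUCIBLE `E[2]` through the
Borel field (`= ℚ`, `r₁ = 1`, inside the Lim@2 scope rider) and deliberately left the CYCLIC-CUBIC case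
(`Gal(ℚ(E[2])/ℚ) ≅ C₃`: abelian but totally real, `r₁ = 3`, outside the rider with `L = ℚ(E[2])`). With
`…KatoFineDivisionFieldFourI.lean` (GEN 9: `√−1 ∈ ℚ(E[4])`, so `ℚ(E[2], i) ≤ ℚ(E[4])` with `2`-power index) the honest
carrier `L = ℚ(E[2], i)` — TOTALLY IMAGINARY, hence inside the rider — is available for every curve, and it is ABELIAN
over `ℚ` as soon as `ℚ(E[2])` is (compositum of two finite abelian subextensions of `ℚ̄`: tree
`Literature.NumberTheory.GaloisRepresentations.isAbelianGalois_sup`; `ℚ(i) = ℚ(√−1)` abelian of degree `2`: tree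
`Literature.NumberTheory.QuadraticForms.isAbelianGalois_adjoin_rootSet`). Hence:

* `conjA_two_of_isAbelianGalois_divisionField_two` — **for every elliptic `W/ℚ` with `ℚ(E[2])/ℚ` ABELIAN (rational
  `2`-torsion, or a cyclic-cubic `2`-division field), statement (A) at `(W, 2)`**, granted Lim 2017 Thm. 3.5 at `p = 2`
  (`hLim2`) and Ferrero–Washington (`hFW`) BY NAME, Ferrero–Washington being applied to the abelian, totally imaginary
  field `ℚ(E[2], i)`. The conjectural (A)-input of the hU3 doors on the defect-≥3 block is therefore EXACTLY the
  `S₃`-image case (`[ℚ(E[2]) : ℚ] = 6`; 1 163 of the 1 382 census classes), where Iwasawa's `μ₂ = 0` for the sextic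
  `ℚ(E[2], i)`-towers is open (certified per class by GEN 8's class-group kits on 1 078 of them).
* `addBlock_conjA_two_of_S3` — block form: (A) at `2` on the non-CM `r_an = 0` defect-≥3 curves follows from (A) at `2` on
  those whose `2`-division field is NOT abelian over `ℚ`.

References: [Lim2017FineSelmer] §3 Thm. 3.5, Lemma 3.2; [FerreroWashington1979]; [CoatesSujatha2005] statement (A), Cor. 3.6;
[Serre1972] §IV; [Washington1997] §7.5. Memo: `run/shared/lean/pub/bsd-2adic/addL2x/VERDICT-19098-addL2x-GEN9.md`.
-/

set_option autoImplicit false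
-- sibling precedent (`ByReductionTypeAtTwoAdditiveKatoFineDivisionFieldFourI.lean`): the directory name repeats the summit name
set_option linter.dupNamespace false

noncomputable section

open scoped Classical IntermediateField

namespace Summit.BirchSwinnertonDyer.BirchSwinnertonDyer.Theorems.AddKatoTwo

open WeierstrassCurve Field Literature.NumberTheory.EllipticCurves
  Literature.NumberTheory.EllipticCurves.Rank1Residual
  Literature.NumberTheory.EllipticCurves.Rank1Residual.Typed
  Literature.NumberTheory.IwasawaTheory
  Summit.BirchSwinnertonDyer.Rank1Residual.X5.AddTwoL2

/-- `−1` is not a square in `ℚ`. [folklore] -/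
private theorem not_isSquare_neg_one_rat : ¬ IsSquare (-1 : ℚ) := by
  rintro ⟨r, hr⟩
  have h : (0 : ℚ) ≤ r * r := mul_self_nonneg r
  rw [← hr] at h
  norm_num at h

/-- **`ℚ(E[2], i)/ℚ` is abelian when `ℚ(E[2])/ℚ` is** (`i² = −1`): the compositum of the finite abelian subextensions
`ℚ(E[2])` and `ℚ(i) = ℚ(√−1)` of `ℚ̄`. [cite: Washington1997, §7.5 (abelian fields)] [cite: Serre1972, §IV] -/
theorem isAbelianGalois_divisionField_two_sup_adjoin (W : WeierstrassCurve ℚ) [W.IsElliptic]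
    [hW2 : IsAbelianGalois ℚ (W.divisionField 2)] {i : AlgebraicClosure ℚ} (hi : i ^ 2 = -1) :
    IsAbelianGalois ℚ ↥(W.divisionField 2 ⊔ IntermediateField.adjoin ℚ {i}) := by
  have hi' : i ^ 2 = algebraMap ℚ (AlgebraicClosure ℚ) (-1) := by rw [hi, map_neg, map_one]
  obtain ⟨hfd, hab, -⟩ := Literature.NumberTheory.QuadraticForms.isAbelianGalois_adjoin_rootSet
    (F := ℚ) not_isSquare_neg_one_rat
  rw [Literature.NumberTheory.QuadraticForms.adjoin_rootSet_X_sq_sub_C_eq not_isSquare_neg_one_rat hi'] at hfd hab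
  exact @Literature.NumberTheory.GaloisRepresentations.isAbelianGalois_sup ℚ (AlgebraicClosure ℚ) _ _ _ _
    (W.divisionField 2) (IntermediateField.adjoin ℚ {i}) inferInstance hW2 hfd hab

/-- **Statement (A) at `(W, 2)` for every elliptic `W/ℚ` whose `2`-division field is ABELIAN over `ℚ`** (rational
`2`-torsion or cyclic-cubic `ℚ(E[2])`; equivalently `Gal(ℚ(E[2])/ℚ) ≇ S₃`), granted Lim 2017 Thm. 3.5 at `p = 2` (`hLim2`)
and Ferrero–Washington (`hFW`) BY NAME: Ferrero–Washington gives `μ₂ = 0` for the cyclotomic `ℤ₂`-towers of the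
abelian field `ℚ(E[2], i)`, a TOTALLY IMAGINARY subfield of `ℚ(E[4])` of `2`-power index
(`divisionField_two_sup_adjoin_le_divisionField_four`, `exists_finrank_divisionField_four_eq_pow_mul_divisionField_two_sup_adjoin`)
— the honest witness shape of the Lim@2 scope rider. `∃ γ D` spelling. [cite: Lim2017FineSelmer, §3 Thm. 3.5, Lemma 3.2 and Remark (a)]
[cite: FerreroWashington1979, Theorem] [cite: CoatesSujatha2005, statement (A), Thm. 3.4 and Cor. 3.6] -/
theorem conjA_two_of_isAbelianGalois_divisionField_two
    (hLim2 : Lim2017.thm35_at_two_fineSelmerDual_moduleFinite_of_classicalMuVanishes_of_le_divisionField_four)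
    (hFW : ferreroWashington1979_classicalMuVanishes)
    (W : WeierstrassCurve ℚ) [W.IsElliptic] [IsAbelianGalois ℚ (W.divisionField 2)] :
    ∀ (κ : ZpExtension ℚ 2), κ.IsCyclotomic →
      ∃ (γ : Field.absoluteGaloisGroup ℚ) (D : W.FineSelmerDualData κ γ),
        Module.Finite ℤ_[2] (RestrictScalars ℤ_[2] (IwasawaAlgebra 2) D.X) := by
  obtain ⟨i, hi, -⟩ := exists_sq_eq_neg_one_mem_divisionField_four W two_ne_zero
  haveI := isAbelianGalois_divisionField_two_sup_adjoin W hi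
  exact conjA_two_of_abelianSubfield hLim2 hFW W _ (divisionField_two_sup_adjoin_le_divisionField_four W hi)
    (exists_finrank_divisionField_four_eq_pow_mul_divisionField_two_sup_adjoin W hi)

/-- **Block form: the conjectural input «(A) at `2` on the defect-≥3 block» of the hU3 doors IS «(A) at `2` on the
sub-block whose `2`-division field is NOT abelian over `ℚ»** (the `S₃`-image classes), granted `hLim2` + `hFW` BY NAME.
Conditional; nothing asserted about the `S₃` case. [cite: CoatesSujatha2005, statement (A) and Cor. 3.6]
[cite: Lim2017FineSelmer, §3 Thm. 3.5] [cite: FerreroWashington1979, Theorem] -/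
theorem addBlock_conjA_two_of_S3
    (hLim2 : Lim2017.thm35_at_two_fineSelmerDual_moduleFinite_of_classicalMuVanishes_of_le_divisionField_four)
    (hFW : ferreroWashington1979_classicalMuVanishes)
    (hAS3 : ∀ (W : WeierstrassCurve ℚ) [W.IsElliptic] [W.IsGloballyMinimal], ¬ W.HasCM → W.analyticRank = 0 →
      DefectAtLeastThree W → ¬ IsAbelianGalois ℚ (W.divisionField 2) →
      ∀ (κ : ZpExtension ℚ 2), κ.IsCyclotomic →
        ∃ (γ : Field.absoluteGaloisGroup ℚ) (D : W.FineSelmerDualData κ γ),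
          Module.Finite ℤ_[2] (RestrictScalars ℤ_[2] (IwasawaAlgebra 2) D.X)) :
    ∀ (W : WeierstrassCurve ℚ) [W.IsElliptic] [W.IsGloballyMinimal], ¬ W.HasCM → W.analyticRank = 0 →
      DefectAtLeastThree W →
      ∀ (κ : ZpExtension ℚ 2), κ.IsCyclotomic →
        ∃ (γ : Field.absoluteGaloisGroup ℚ) (D : W.FineSelmerDualData κ γ),
          Module.Finite ℤ_[2] (RestrictScalars ℤ_[2] (IwasawaAlgebra 2) D.X) := by
  intro W _ _ hcm hr hdef
  by_cases hab : IsAbelianGalois ℚ (W.divisionField 2)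
  · exact conjA_two_of_isAbelianGalois_divisionField_two hLim2 hFW W
  · exact hAS3 W hcm hr hdef hab

end Summit.BirchSwinnertonDyer.BirchSwinnertonDyer.Theorems.AddKatoTwo

end
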